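import Summits.Langlands.Langlands.Theorems.IrreducibilityBySelfDualityReciprocityUpToIrreducibilityRInvariantMeasureGLQuot
import Literature.NumberTheory.Automorphic.InvariantMeasureGLModUnipotent
import HarnessLib

/-!
# The named fact `exists_smulInvariantMeasure_glQuotUpperUnitriangular` at every local field — stub (Fν) of line
`PhantomRMJunctionOfPieces` (crux stmt-Langlands-13643), DISCHARGED from the proved invariant-measure theorem of
line `Sketch` (crux stmt-Langlands-17925)

`Summit.Langlands.Langlands.Theorems.ReciprocityUpToIrreducibilityR.stub_exists_invariantMeasure_glQuotient`
(p158762) constructs, for the BOREL σ-algebra of `GL_m(F) ⧸ U_m(F)`, a `GL_m(F)`-invariant measure finite on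
compact sets and positive on non-empty open sets (Weil's theorem for the unimodular pair `GL_m(F) ⊇ U_m(F)`,
via `Literature.MeasureTheory.Group.quotientMeasure`).  The named fact
`Literature.NumberTheory.Automorphic.exists_smulInvariantMeasure_glQuotUpperUnitriangular F` asks the same
for the measurable structure supplied by the consumer together with a `BorelSpace` instance; such a structure IS
the Borel one (`BorelSpace.measurable_eq`), so the statement follows by transport along that equality.
No definitions; standard axioms; no `sorry`.
-/

noncomputable section

set_option linter.dupNamespace false

open scoped MatrixGroups
open MeasureTheory
open Literature.NumberTheory.Automorphic

namespace Summit.Langlands.Langlands.Theorems.PhantomRMJunctionOfPieces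

/-- **Stub (Fν) of line `PhantomRMJunctionOfPieces` (crux stmt-Langlands-13643): the named fact
`exists_smulInvariantMeasure_glQuotUpperUnitriangular` holds at every non-archimedean local field** — for
every `m` and every Borel measurable structure on `GL_m(F) ⧸ U_m(F)` there is a `GL_m(F)`-invariant measure,
finite on compacts and positive on non-empty opens.  Transport of the proved
`ReciprocityUpToIrreducibilityR.stub_exists_invariantMeasure_glQuotient` (stated for the Borel σ-algebra)
along `BorelSpace.measurable_eq`. [cite: DeitmarEchterhoff2014, Thm. 1.5.3] -/
theorem stub_exists_smulInvariantMeasure_glQuotUpperUnitriangular :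
    ∀ (F : Type) [Field F] [ValuativeRel F] [TopologicalSpace F] [IsNonarchimedeanLocalField F],
      exists_smulInvariantMeasure_glQuotUpperUnitriangular F := by
  intro F _ _ _ _ m inst hB
  obtain ⟨ms, hb, ν, h1, h2, h3⟩ :=
    ReciprocityUpToIrreducibilityR.stub_exists_invariantMeasure_glQuotient F m
  have hms : ms = inst := by rw [hb.measurable_eq, hB.measurable_eq]
  subst hms
  exact ⟨ν, h1, h2, h3⟩

end Summit.Langlands.Langlands.Theorems.PhantomRMJunctionOfPieces

end
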